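import Summits.Langlands.Langlands.Theses.PicardMuOrdinary
import Summits.Langlands.Langlands.Theorems.PicardMuOrdinaryMuOrdinaryFamilyRTCharZeroDefs
import HarnessLib

/-!
# Crux `MuOrdinaryFamilyRT` (stmt-Langlands-13757), line `mod3n-successive-approximation`: the typed vocabulary and
# the STATEMENTS of the six registered stubs (Defs file)

This file LANDS, verbatim from the registered skeleton `Cruxes/MuOrdinaryFamilyRT/Lines/mod3n_successive_approximation.lean`
(planner-cruxplan-stmt-Langlands-13757-mod3n-successive-app-0; registered by the lead prover-line-stmt-Langlands-13757-a1-0 with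
`ledger skeleton check`, 2026-08-16: stubs `stub_picardFact`, `stub_liePlaces`, `stub_modNAutomorphy`, `stub_levelLowering`,
`stub_hidaLimitHost`, `stub_remainder`), the line's typed notions (§1 Lie-killing places: `cyc`, `steinbergPoly`, `LiePlaceAt`,
`HasLiePlaces`, `HasExactSteinberg`, `Scope`; §2 automorphy modulo `3^N` typed on the Galois side: `IsAutomorphicOfLevel`,
`IsPolarized`, `InertiallyBoundedBy`, `IsUnipotentOnInertiaAt`, `IsBorelFrameAt`, `diagChar`, `IsApproxPoint`, `AutomorphicMod`)
the STATEMENTS `S.stub_*` of its six stubs (§3) and the skeleton's sorry-free glue `LiePlaceAt.mono`,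
`exists_finset_liePlaces` (§4), in the skeleton's namespace
`Summit.Langlands.Langlands.Cruxes.MuOrdinaryFamilyRT.Mod3nSuccessiveApproximation`, so that a landed stub
`theorem stub_<name> : S.stub_<name>` reads byte-identically to its registration and the sorry-free composition can import it
(same convention as the landed `…CharZeroDefs.lean`, p111741, and `…Defs.lean` of free-seed).  NOTHING IS ASSERTED here: every
`def … : Prop` below is a statement consumed only as (part of) the type of a stub theorem or of the crux.  Statements are
unchanged from the skeleton; only this module docstring is new.  Rationale, intended witnesses and sources of every notion:
the skeleton's docstrings (kept below) and the line card `Cruxes/MuOrdinaryFamilyRT/Lines/mod3n-successive-approximation.md`.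
Imported and reused (landed): `K`, `Generic`, `PicardInput`, `ResidualHyp`, `LimitConcl`, `crux_iff`, `IsMuOrdinaryAtThree`,
`IsUpper3`, `Roots`, `stub_picardInput_of` (p86963), `stub_accumulation` (p85419), `stub_dictionary` (p85480) of
`…CharZeroDefs.lean` and its imports.
-/

set_option linter.dupNamespace false

namespace Summit.Langlands.Langlands.Cruxes.MuOrdinaryFamilyRT.Mod3nSuccessiveApproximation

open scoped NumberField Polynomial Matrix Classical
open Field IsDedekindDomain Polynomial
open Literature.NumberTheory.GaloisRepresentations Literature.NumberTheory.Automorphic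
open Summit.Langlands.Langlands.Cruxes.MuOrdinaryFamilyRT.CharZeroDominance
  (K Generic PicardInput ResidualHyp LimitConcl crux_iff IsMuOrdinaryAtThree IsUpper3 Roots
    stub_picardInput_of stub_accumulation stub_dictionary instIsGaloisK)

noncomputable section

/-! ## 1. Lie-killing (Khare–Thorne) places for `ρ_C` -/

/-- The `3`-adic cyclotomic character of `Γ_K`, read in `ℚ̄₃`. -/
def cyc (σ : absoluteGaloisGroup K) : PadicAlgCl 3 :=
  algebraMap ℤ_[3] (PadicAlgCl 3) (((GaloisRep.cyclotomicCharacter K 3 σ : ℤ_[3]ˣ) : ℤ_[3]))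

/-- The **Steinberg-shaped cubic** `(X − a)(X − aν)(X − aν²)`: characteristic polynomial of a geometric Frobenius on the
`St(uni)` component (Khare–Thorne's `D_v^{St(uni)}`: upper triangular with diagonal `χ, χε⁻¹, χε⁻²`), `ν = N v`. -/
def steinbergPoly (a ν : PadicAlgCl 3) : (PadicAlgCl 3)[X] :=
  (X - C a) * (X - C (a * ν)) * (X - C (a * ν ^ 2))

/-- **`v` is a Lie-killing place modulo `3^N` for `(f, ρ)`**: `v ∤ 3`, `N v ≡ 4, 7 (mod 9)` (`≡ 1 mod 3`, `≢ 1 mod 9`),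
`f mod v` has exactly ONE root in `k_v` (Frobenius is a 3-cycle of `S₄`, i.e. the regular unipotent `J₃` on the heart
`𝔽₃^{roots}/diag` — the classes on which the Lie classes `H¹(A₄/S₄, ad⁰) ≠ 0` restrict non-trivially, toy
`toy-lie_classes_c3_results.json`, confirmed j011016), `ρ` is unramified at `v`, and the characteristic polynomial of a
GEOMETRIC Frobenius `τ⁻¹` (convention of `PicardInput`) is Steinberg-shaped `(X − a)(X − a·Nv)(X − a·Nv²)` modulo `3^N`
(coefficientwise, `3`-adic norm `≤ 3^{-N}`) for a unit `a`.  [KhareThorne2016 §6.2, Lemma 6.8] -/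
def LiePlaceAt (f : ℤ[X]) (ρ : FramedGaloisRep K (PadicAlgCl 3) 3) (N : ℕ)
    (v : HeightOneSpectrum (𝓞 K)) : Prop :=
  ((3 : ℕ) : 𝓞 K) ∉ v.asIdeal ∧
  (v.residueCard % 9 = 4 ∨ v.residueCard % 9 = 7) ∧
  (f.map ((Ideal.Quotient.mk v.asIdeal).comp (algebraMap ℤ (𝓞 K)))).roots.toFinset.card = 1 ∧
  ρ.IsUnramifiedAt v ∧
  ∃ a : PadicAlgCl 3, ‖a‖ = 1 ∧
    ∀ 𝔓 ∈ v.primesAbove, ∀ τ : absoluteGaloisGroup K, IsArithFrobAt (𝓞 K) τ 𝔓 →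
      ∀ i : ℕ, ‖(FramedRep.charpoly ρ τ⁻¹).coeff i -
          (steinbergPoly a (v.residueCard : PadicAlgCl 3)).coeff i‖ ≤ ((3 : ℝ)⁻¹) ^ N

/-- **Lie-killing places exist at every depth**: for every `N` there are Lie places mod `3^N` outside any finite set. -/
def HasLiePlaces (f : ℤ[X]) (ρ : FramedGaloisRep K (PadicAlgCl 3) 3) : Prop :=
  ∀ (N : ℕ) (T : Finset (HeightOneSpectrum (𝓞 K))), ∃ v ∉ T, LiePlaceAt f ρ N v

/-- **The image of `ρ` contains an EXACTLY Steinberg-shaped element over a 3-cycle** (triage r1-2 / r1-3 sharpening of the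
card's K3: by Chebotarev + compactness, `HasLiePlaces` is equivalent to this, NOT to mere openness of the `3`-adic image):
some `σ ∈ Γ_K` acts on the four roots of `f` with exactly one fixed point (a 3-cycle), `v₃(ε(σ) − 1) = 1`, and
`det(X − ρ(σ)) = (X − a)(X − aν)(X − aν²)` on the nose with `ν = ε(σ)⁻¹`, `a` a unit.  A condition on the `λ²`-level of the
image (`Γ(λ^m)`, `m ≥ 3`, contains no such element), decidable per `f` by a finite computation (`λ⁴`-torsion field of `J`). -/
def HasExactSteinberg (f : ℤ[X]) (ρ : FramedGaloisRep K (PadicAlgCl 3) 3) : Prop :=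
  ∃ (σ : absoluteGaloisGroup K) (a : PadicAlgCl 3),
    Nat.card (MulAction.fixedBy (Roots f) σ) = 1 ∧ ‖a‖ = 1 ∧ ‖cyc σ - 1‖ = (3 : ℝ)⁻¹ ∧
      FramedRep.charpoly ρ σ = steinbergPoly a (cyc σ)⁻¹

/-- **The scope of the line** (Galois side, per `(f, ρ_C)`): `ρ_C` μ-ordinary at `3` (landed `IsMuOrdinaryAtThree`; BBW
types (b), (d), (e) minus purity failures; non-empty and generic: `3x⁴ + x³ − 54`, Disproof F12b), an exact Steinberg element
in the image (K3's true content).  (The three inertial diagonal characters of a μ-ordinary `ρ_C` at `λ` have pairwise distinct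
Hodge–Tate types `(0,0)`, `(0,1)|(1,0)`, `(1,1)`, so the weight-congruence clause of `AutomorphicMod` pins the ordering of every
witness's frame to that of the chosen frame of `ρ_C` as soon as `N` is large: no `λ`-distinguishedness clause is needed.) -/
def Scope (f : ℤ[X]) (ρC : FramedGaloisRep K (PadicAlgCl 3) 3) : Prop :=
  IsMuOrdinaryAtThree ρC ∧ HasExactSteinberg f ρC

/-! ## 2. Automorphy modulo `3^N` at bounded level, typed on the Galois side -/

/-- `ρ` is **automorphic of level `S'`**: attached (lang.S27 unramified compatibility at `𝔭 ∉ S'`, `𝔭 ∤ 3`) to a regular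
algebraic cuspidal `P` on `GL₃(𝔸_K)` which is unramified with integrally normalised Satake trace `N𝔭·Σα ∈ ℤ̄` at every
`𝔭 ∉ S'` — verbatim the output shape of the landed `S.stub_quadraticDescent`, so that the landed dictionary applies. -/
def IsAutomorphicOfLevel (hcpt : isCompact_glFiniteIntegralLevel 3 (CyclotomicField 3 ℚ))
    (ι : PadicAlgCl 3 ≃+* ℂ) (S' : Finset (HeightOneSpectrum (𝓞 K)))
    (ρ : FramedGaloisRep K (PadicAlgCl 3) 3) : Prop :=
  ∃ P : CuspidalAutomorphicRepData 3 (CyclotomicField 3 ℚ) hcpt,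
    P.1.IsRegularAlgebraic ∧
    ∀ 𝔭 ∉ S', (∃ (α : Multiset ℂ) (t₀ : integralClosure ℤ ℂ),
        P.1.HasSatakeParamAt 𝔭 α ∧ (t₀ : ℂ) = (𝔭.residueCard : ℂ) * α.sum) ∧
      (((3 : ℕ) : 𝓞 K) ∉ 𝔭.asIdeal → IsGaloisCompatibleAt P.1 ι ρ 𝔭)

/-- `ρ` is **polarized** (essentially conjugate self-dual, in trace form): `tr ρ(c σ c⁻¹) = μ(σ)·tr ρ(σ⁻¹)` for a continuous
character `μ` and every complex conjugation `c` — the shape of `r(Π) ⊗ ψ` for `Π` RACSDC and `ψ` an algebraic Hecke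
character (PARITY-NOTE: the approximants of `ρ_C`, `ρ_C^c ≅ ρ_C^∨ ε^{∓1}`, are `ψ`-twists, never RACSDC themselves, F13). -/
def IsPolarized (ρ : FramedGaloisRep K (PadicAlgCl 3) 3) : Prop :=
  ∃ μ : absoluteGaloisGroup K →ₜ* (PadicAlgCl 3)ˣ,
    ∀ c : absoluteGaloisGroup ℚ, IsComplexConjugation (algebraMap ℚ ℝ) c →
      ∀ σ : absoluteGaloisGroup K,
        FramedRep.trace ρ (absGaloisOuterConj ℚ K c σ) = ((μ σ : (PadicAlgCl 3)ˣ) : PadicAlgCl 3) * FramedRep.trace ρ σ⁻¹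

/-- **Inertial level of `ρ` at `w` bounded by that of `ρC`**: `ρ` kills the kernel of `ρC` on the inertia group at `w`
(so `ρ|I_w` factors through the finite — or tame-by-finite — inertial quotient of `ρC`: bounded conductor, i.e. a FIXED
tame level `U_w` at the bad places, as the fixed-type deformation conditions at `v ∈ S` produce). -/
def InertiallyBoundedBy (w : HeightOneSpectrum (𝓞 K)) (ρC ρ : FramedGaloisRep K (PadicAlgCl 3) 3) : Prop :=
  ∀ τ ∈ absInertia (w.adicCompletion K),
    ρC (absGaloisRestrict K (w.adicCompletion K) τ) = 1 → ρ (absGaloisRestrict K (w.adicCompletion K) τ) = 1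

/-- **`ρ` is unipotent on inertia at `w`** (Iwahori level `U₀(w)`: tamely ramified with unipotent monodromy, or unramified). -/
def IsUnipotentOnInertiaAt (w : HeightOneSpectrum (𝓞 K)) (ρ : FramedGaloisRep K (PadicAlgCl 3) 3) : Prop :=
  ∀ τ ∈ absInertia (w.adicCompletion K),
    ((ρ (absGaloisRestrict K (w.adicCompletion K) τ)).val - 1) ^ 3 = 0

/-- **`g` is a Borel frame of `ρ` at `v`**: the whole decomposition group at `v` acts upper-triangularly in the frame `g`
(the shape `IsMuOrdinaryAtThree` / `OrdFamily.ordinaryAt` use; "ordinary at `λ`" for a de Rham `ρ`). -/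
def IsBorelFrameAt (v : HeightOneSpectrum (𝓞 K)) (ρ : FramedGaloisRep K (PadicAlgCl 3) 3)
    (g : GL (Fin 3) (PadicAlgCl 3)) : Prop :=
  ∀ τ : absoluteGaloisGroup (v.adicCompletion K),
    IsUpper3 (g⁻¹ * ρ (absGaloisRestrict K (v.adicCompletion K) τ) * g).val

/-- The `j`-th **ordered diagonal character** of `ρ` at `v` in the frame `g` (the weight coordinates: under a point of Hida's
`𝕋^{ord}` the weight algebra `Λ = 𝒪⟦T(ℤ₃)⟧` and the `U_λ`-operators are read off these values on `Γ_{K_v}`). -/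
def diagChar (v : HeightOneSpectrum (𝓞 K)) (ρ : FramedGaloisRep K (PadicAlgCl 3) 3)
    (g : GL (Fin 3) (PadicAlgCl 3)) (j : Fin 3) (τ : absoluteGaloisGroup (v.adicCompletion K)) : PadicAlgCl 3 :=
  (g⁻¹ * ρ (absGaloisRestrict K (v.adicCompletion K) τ) * g).val j j

/-- **Approximate `𝒪`-algebra point of precision `r`** of the `𝒪_{ℚ̄₃}`-subalgebra `A` of `∏_{i<m} ℚ̄₃` generated by `G`:
a function `θ` which on `A` is integral, unital, additive, multiplicative and `𝒪`-linear up to errors of norm `≤ r`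
(equivalently: an `𝒪`-algebra homomorphism `A → 𝒪/(elements of norm ≤ r)`; for `m = 0` and `r < 1` no such `θ` exists). -/
def IsApproxPoint {m : ℕ} (r : ℝ) (G : Set (Fin m → PadicAlgCl 3))
    (θ : (Fin m → PadicAlgCl 3) → PadicAlgCl 3) : Prop :=
  let A : Subalgebra (Valued.integer (PadicAlgCl 3)) (Fin m → PadicAlgCl 3) :=
    Algebra.adjoin (Valued.integer (PadicAlgCl 3)) G
  (∀ a ∈ A, ‖θ a‖ ≤ 1) ∧ ‖θ 1 - 1‖ ≤ r ∧
  (∀ a ∈ A, ∀ b ∈ A, ‖θ (a + b) - (θ a + θ b)‖ ≤ r ∧ ‖θ (a * b) - θ a * θ b‖ ≤ r) ∧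
  (∀ (c : Valued.integer (PadicAlgCl 3)), ∀ a ∈ A, ‖θ (c • a) - (c : PadicAlgCl 3) * θ a‖ ≤ r)

/-- **`ρC` is automorphic modulo `3^N` at level `(S₀; Y)`** — Thorne's "`ρ mod p^N` is automorphic of level `U`"
(Thorne 2016 §4, before Thm 4.14; Khare–Thorne 2016 §5) for the ORDINARY Hecke algebra of the definite `U(3)_{K/ℚ}`, typed
Galois-side as explained in the module docstring: for the place `v ∣ 3`, a Borel frame `g` of `ρC` there and finitely many
automorphic (`IsAutomorphicOfLevel`, level `S₀ ∪ Y`), polarized, Borel-framed, inertially bounded (inside `S₀`), Iwahori-at-`Y`,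
residually-`ρ̄C` (characteristic polynomials congruent mod `𝔪_{ℤ̄₃}`: Brauer–Nesbitt-proof at `p = n = 3`) Galois representations
whose ordered inertial diagonal characters at `λ` are congruent mod `3^N` to those of `ρC` in the frame `g` ("of weight and
nebentype `κ_N ≡ κ_C (mod 3^N)`"; this also pins the ordering of every frame `gs i` to that of `g`), and whose
charpoly-and-weight algebra has an approximate `𝒪`-point of precision `3^{-N}` through (the characteristic polynomials of `ρC`,
the diagonal characters of `ρC` in the frame `g` on the whole decomposition group — the `U_λ`-coordinates). -/
def AutomorphicMod (hcpt : isCompact_glFiniteIntegralLevel 3 (CyclotomicField 3 ℚ)) (ι : PadicAlgCl 3 ≃+* ℂ)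
    (N : ℕ) (S₀ Y : Finset (HeightOneSpectrum (𝓞 K))) (ρC : FramedGaloisRep K (PadicAlgCl 3) 3) : Prop :=
  ∀ v : HeightOneSpectrum (𝓞 K), ((3 : ℕ) : 𝓞 K) ∈ v.asIdeal →
    ∃ (g : GL (Fin 3) (PadicAlgCl 3)) (m : ℕ) (ρs : Fin m → FramedGaloisRep K (PadicAlgCl 3) 3)
      (gs : Fin m → GL (Fin 3) (PadicAlgCl 3)) (θ : (Fin m → PadicAlgCl 3) → PadicAlgCl 3),
      IsBorelFrameAt v ρC g ∧
      (∀ i, IsAutomorphicOfLevel hcpt ι (S₀ ∪ Y) (ρs i) ∧ IsPolarized (ρs i) ∧ IsBorelFrameAt v (ρs i) (gs i) ∧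
        (∀ w ∈ S₀, ((3 : ℕ) : 𝓞 K) ∉ w.asIdeal → InertiallyBoundedBy w ρC (ρs i)) ∧
        (∀ w ∈ Y, IsUnipotentOnInertiaAt w (ρs i)) ∧
        (∀ (σ : absoluteGaloisGroup K) (k : ℕ),
          ‖(FramedRep.charpoly (ρs i) σ).coeff k - (FramedRep.charpoly ρC σ).coeff k‖ < 1) ∧
        (∀ τ ∈ absInertia (v.adicCompletion K), ∀ j : Fin 3,
          ‖diagChar v (ρs i) (gs i) j τ - diagChar v ρC g j τ‖ ≤ ((3 : ℝ)⁻¹) ^ N)) ∧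
      IsApproxPoint (((3 : ℝ)⁻¹) ^ N)
        (Set.range (fun p : absoluteGaloisGroup K × ℕ => fun i => (FramedRep.charpoly (ρs i) p.1).coeff p.2) ∪
          Set.range (fun p : absoluteGaloisGroup (v.adicCompletion K) × Fin 3 =>
            fun i => diagChar v (ρs i) (gs i) p.2 p.1)) θ ∧
      (∀ (σ : absoluteGaloisGroup K) (k : ℕ),
        ‖θ (fun i => (FramedRep.charpoly (ρs i) σ).coeff k) - (FramedRep.charpoly ρC σ).coeff k‖ ≤ ((3 : ℝ)⁻¹) ^ N) ∧
      (∀ (τ : absoluteGaloisGroup (v.adicCompletion K)) (j : Fin 3),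
        ‖θ (fun i => diagChar v (ρs i) (gs i) j τ) - diagChar v ρC g j τ‖ ≤ ((3 : ℝ)⁻¹) ^ N)

/-! ## 3. Statements of the stubs -/

/-- FACT STUB A — the `λ`-adic representation of a Picard curve (named Literature fact `picardCurve_exists_lambdaAdicRep`,
Upton 2009 / Serre–Tate / SGA 4½; feeds the landed conditional `stub_picardInput_of`, p86963).  Size L (no étale `H¹` of
curves in the tree). -/
def S.stub_picardFact : Prop :=
  Literature.NumberTheory.GaloisRepresentations.picardCurve_exists_lambdaAdicRep

/-- **K3 — `S.stub_liePlaces` (Chebotarev transport; size M–L, provable in principle from a Chebotarev density fact).**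
For generic `f` with Picard input `ρ_C`: ONE exactly Steinberg-shaped 3-cycle element in the image gives Lie-killing places
modulo `3^N` for EVERY `N`, outside any finite set.  Proof sketch: the set of `σ` acting as a 3-cycle on the roots with
`det(X − ρ_C σ)` within `3^{-N}` of `steinbergPoly a (ε σ)⁻¹` is open (continuity of `ρ_C`, `ε`), conjugation-stable and
contains the given element; Chebotarev puts geometric Frobenii `Frob_v⁻¹… ` of infinitely many `v ∉ S₀ ∪ T` in it, and for
such `v`: `ε(Frob_v) = N v`, so `N v ≡ 4, 7 (9)`, `f mod v` has one root, `ρ_C` is unramified (PicardInput).  Why it might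
fail: only through the conventions (arithmetic/geometric Frobenius vs `ν = ε(σ)⁻¹`), which are aligned with `PicardInput`.
[KhareThorne2016 Lemma 6.8; Chebotarev] -/
def S.stub_liePlaces : Prop :=
  ∀ (f : ℤ[X]) (ι : PadicAlgCl 3 ≃+* ℂ) (e : K →+* ℂ) (S₀ : Finset (HeightOneSpectrum (𝓞 K)))
    (ρC : FramedGaloisRep K (PadicAlgCl 3) 3),
    Generic f → PicardInput f ι e S₀ ρC → HasExactSteinberg f ρC → HasLiePlaces f ρC

/-- **K1 — `S.stub_modNAutomorphy` (THE LEVER, hardest; size XL, research).**  For `(f, ρ_C)` in scope and residually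
automorphic (the crux's `hres`), there are a number `r` of auxiliary places and a precision loss `c` such that for every `N`
and every set `Y` of at least `r` Lie-killing places mod `3^{N+c}` disjoint from `S₀`, `ρ_C` is automorphic mod `3^N` at level
`(S₀; Y)` (`c` absorbs the passage from "charpoly `≡` Steinberg mod `3^{N+c}`" at a residually regular-unipotent Frobenius to
"`ρ_C mod 3^N ∈ D_v^{St(uni)}`": a regular matrix is conjugate to the triangularised companion matrix of its split
characteristic polynomial, root continuity costs two powers of `3`).  Intended proof
(Khare–Thorne 2016 §§6–7 / Thorne 2016 Thm 4.14 transposed to the definite `U(3)_{K/ℚ}` after the CM twist `ψ`): (P3) an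
ordinary residual seed of regular weight `κ_N ≡ κ_C (mod 2·3^{N−1})` and level `U^p(S₀)U₀(Y)` in the `St(uni)` component —
Hida family of `BC(Sym² g) ⊗ ψ` / of the CM seed, level-RAISED at `Y` (Bellaïche–Graftieaux 2006; the congruence is automatic
at unipotent `ρ̄(Frob_w)`); then `R_{𝒮_N} → 𝕋_{𝒮_N}` with nilpotent kernel for `𝒮_N = {B-ordinary of weight κ_N at λ; fixed
types on S₀; D^{St(uni)} at Y; Taylor–Wiles places}` by Kisin–Taylor–Wiles patching in DEFECT ZERO with the `𝔷 ⊂ ad⁰`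
bookkeeping (`h⁰(ad⁰) = h⁰(ad⁰(1)) = 1` cancel), the Lie classes `H¹(im ρ̄, ad⁰) ≠ 0` (toy: dimension `1` for `A₄` and
`S₄`, restricting non-trivially exactly to `C₃`) being killed by the `St(uni)` condition at `Y` (GL₃ analogue of KT16
Prop 6.6: Lie subspace `⊄ L_v^⊥`); `ρ_C mod 3^N` is a point of `R_{𝒮_N}` BY THE CHOICE of `Y` and of `κ_N`, whence an
`𝒪/3^N`-point of `𝕋_{𝒮_N}`, i.e. `AutomorphicMod … N S₀ Y ρ_C`.  Why it might fail: the GL₃/`U(3)` analogue of KT16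
Prop 6.6 is an uncomputed local statement; for `A₄` the off-diagonal classes `O ≅ V ⊕ V` must also be routed through `Y`;
ordinary deformation rings and Hida theory at the RAMIFIED quasi-split `U(2,1)(ℚ₃)` and `ζ₃ ∈ K` are outside every printed
hypothesis (CHT 2008, Thorne 2012, Geraghty 2018).  Honours Disproof F3 (no `P₁` from `hres`), F13 (ψ-twist).
[KhareThorne2016 §6.2 Prop 6.6, Lemmas 6.7–6.8, §7; Thorne2016 §4; Thorne2012; BellaicheGraftieaux2006; Geraghty2018;
ClozelHarrisTaylor2008; Kisin2009; toy j011016] -/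
def S.stub_modNAutomorphy : Prop :=
  ∀ (f : ℤ[X]) (hcpt : isCompact_glFiniteIntegralLevel 3 (CyclotomicField 3 ℚ))
    (ι : PadicAlgCl 3 ≃+* ℂ) (e : K →+* ℂ) (S₀ : Finset (HeightOneSpectrum (𝓞 K)))
    (ρC : FramedGaloisRep K (PadicAlgCl 3) 3),
    Generic f → PicardInput f ι e S₀ ρC → Scope f ρC → ResidualHyp f hcpt →
    ∃ r c : ℕ, ∀ (N : ℕ) (Y : Finset (HeightOneSpectrum (𝓞 K))),
      r ≤ Y.card → Disjoint Y S₀ → (∀ v ∈ Y, LiePlaceAt f ρC (N + c) v) →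
        AutomorphicMod hcpt ι N S₀ Y ρC

/-- **K2 — `S.stub_levelLowering` (level-lowering modulo `3^N` at the Lie-killing places; size L–XL).**  If `ρ_C` is
automorphic mod `3^{N+c}` at level `(S₀; Y)` for a set `Y` of Lie-killing places mod `3^{N+c}` (`N w ≢ 1 mod 9`, `ρ_C(Frob_w)`
Steinberg-shaped, witnesses Iwahori-unipotent at `w`), then it is automorphic mod `3^N` at level `(S₀; ∅)` (`c` = a precision
loss depending on `(f, ρ_C)` only): Mazur's principle mod `p^N` (Thorne 2016 Thm 4.14 / Prop 4.16, one place at a time;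
Khare–Thorne 2016 Thm 5.4, the `(N w − 1)`-torsion error bounded because `N w ≢ 1 mod 9`) transposed from quaternion
algebras to the definite `U(3)`: at
INERT `w` the group `U(2,1)(ℚ_ℓ)` has rank one (a tree; two adjacent vertex stabilisers + strong approximation for `SU(2,1)`),
at SPLIT `w` this is Ihara's lemma for `U(3)` in the non-generic (unipotent) case.  Why it might fail: the split case is
CHT's open Ihara conjecture (Boyer's geometric Mazur principle covers only the generic case); the inert case is unwritten.
[Thorne2016 §4 Thm 4.14, Prop 4.16; KhareThorne2016 §5 Thm 5.4; BellaicheGraftieaux2006; Boyer2026MazurPrinciple;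
ClozelHarrisTaylor2008] -/
def S.stub_levelLowering : Prop :=
  ∀ (f : ℤ[X]) (hcpt : isCompact_glFiniteIntegralLevel 3 (CyclotomicField 3 ℚ))
    (ι : PadicAlgCl 3 ≃+* ℂ) (e : K →+* ℂ) (S₀ : Finset (HeightOneSpectrum (𝓞 K)))
    (ρC : FramedGaloisRep K (PadicAlgCl 3) 3),
    Generic f → PicardInput f ι e S₀ ρC → Scope f ρC →
    ∃ c : ℕ, ∀ (N : ℕ) (Y : Finset (HeightOneSpectrum (𝓞 K))),
      Disjoint Y S₀ → (∀ v ∈ Y, LiePlaceAt f ρC (N + c) v) →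
        AutomorphicMod hcpt ι (N + c) S₀ Y ρC → AutomorphicMod hcpt ι N S₀ ∅ ρC

/-- **K4 — `S.stub_hidaLimitHost` (the card's Transfer `C⁺ ⇒ crux` in host form = ordinary Hida theory for the definite
`U(3)_{K/ℚ}` at the NON-SPLIT prime `3` + successive approximation; size XL).**  If `(f, ρ_C)` is in scope and `ρ_C` is
automorphic mod `3^N` at level `(S₀; ∅)` for EVERY `N`, then there are: a normal Noetherian domain `Λ` (intended
`𝒪⟦T(ℤ₃)⟧`, `T` the torus of the Borel of the ramified quasi-split `U(2,1)(ℚ₃)`, relative dimension `3`), a finite `Λ`-algebra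
`R` (intended `𝕋^{ord}(U^p(S₀))_𝔪 ⊗ ψ`-bookkeeping, Geraghty-style vertical control) with a trace map `T : Γ_K → R`, an HONEST
point `x : R → ℚ̄₃` with `x ∘ T = tr ρ_C` (successive approximation: the approximate points `θ_N` transported to `𝕋^{ord}`
by the envelope property and compactness / König — the card's `successiveApprox` = Mathlib `PadicInt.lift`), dominant
(`∃ 𝔮 prime ⊆ ker x` with `𝔮 ∩ Λ = ⊥`: `𝕋^{ord}` is torsion-free over `Λ` — LOAD-BEARING, Disproof p74393), integral on `Λ`,
a set `D` of `E`-integral arithmetic weights accumulating uniformly at `x|_Λ` (regular dominant weights `≡ κ_C`), and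
CLASSICALITY: every `ℚ̄₃`-point `y` of `R` over `D` has `y ∘ T = tr ρ_y` for a `ρ_y` automorphic of a fixed level `S ∋ λ`
(Hida–Geraghty control on the definite group + Rogawski base change `U(3) → GL₃/K` + lang.S27, twisted back by `ψ`).
Why it might fail: printed unitary Hida theory assumes `p` SPLIT in `K/ℚ` (Geraghty 2018, CHT); at the ramified quasi-split
`3` the `U_λ`-operators, ordinary projector, torsion-freeness over the rank-3 `Λ` and the attached Galois representations must
be redone (Emerton's `Ord_B` is general, the arithmetic normalisations are not); without torsion-freeness the statement is
FALSE (constant-family junk, `stub_accumulation_false_without_dominance`).  [Geraghty2018; Hida; ClozelHarrisTaylor2008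
§3.3; Rogawski1990; Thorne2016 Cor 4.15; Chenevier2014 determinants] -/
def S.stub_hidaLimitHost : Prop :=
  ∀ (f : ℤ[X]) (hcpt : isCompact_glFiniteIntegralLevel 3 (CyclotomicField 3 ℚ))
    (ι : PadicAlgCl 3 ≃+* ℂ) (e : K →+* ℂ) (S₀ : Finset (HeightOneSpectrum (𝓞 K)))
    (ρC : FramedGaloisRep K (PadicAlgCl 3) 3),
    Generic f → PicardInput f ι e S₀ ρC → Scope f ρC →
    (∀ N : ℕ, AutomorphicMod hcpt ι N S₀ ∅ ρC) →
    ∃ (Λ R : Type) (_ : CommRing Λ) (_ : IsDomain Λ) (_ : IsNoetherianRing Λ) (_ : IsIntegrallyClosed Λ)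
      (_ : CommRing R) (_ : Algebra Λ R) (_ : Module.Finite Λ R)
      (T : absoluteGaloisGroup K → R) (x : R →+* PadicAlgCl 3)
      (D : Set (Λ →+* PadicAlgCl 3)) (E : IntermediateField ℚ_[3] (PadicAlgCl 3))
      (S : Finset (HeightOneSpectrum (𝓞 K))),
      (∀ σ, x (T σ) = FramedRep.trace ρC σ) ∧
      FiniteDimensional ℚ_[3] E ∧
      (∃ 𝔮 : Ideal R, 𝔮.IsPrime ∧ Ideal.comap (algebraMap Λ R) 𝔮 = ⊥ ∧ ∀ r ∈ 𝔮, x r = 0) ∧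
      (∀ a : Λ, ‖x (algebraMap Λ R a)‖ ≤ 1) ∧
      (∀ κ ∈ D, ∀ a : Λ, κ a ∈ E ∧ ‖κ a‖ ≤ 1) ∧
      (∀ M : ℕ, ∃ κ ∈ D, ∀ a : Λ, ‖κ a - x (algebraMap Λ R a)‖ ≤ ((3 : ℝ)⁻¹) ^ M) ∧
      (∀ v : HeightOneSpectrum (𝓞 K), ((3 : ℕ) : 𝓞 K) ∈ v.asIdeal → v ∈ S) ∧
      (∀ y : R →+* PadicAlgCl 3, y.comp (algebraMap Λ R) ∈ D →
        ∃ ρy : FramedGaloisRep K (PadicAlgCl 3) 3,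
          (∀ σ, FramedRep.trace ρy σ = y (T σ)) ∧ IsAutomorphicOfLevel hcpt ι S ρy)

/-- **`S.stub_remainder` — NOT a lemma of the line: the conceded complement.**  The crux verbatim for generic `f` with its
Picard representation OUTSIDE the scope (`ρ_C` not μ-ordinary at `3`: BBW types (a), (c) — the route's foreseen
`RTSupersingular`, no engine in any line, Disproof F8/F12c; or no exact Steinberg element in the image; or `f` without a
unique root in `ℚ₃`).  Registered only so that the composition concludes the crux BY NAME. -/
def S.stub_remainder : Prop :=
  ∀ (f : ℤ[X]) (hcpt : isCompact_glFiniteIntegralLevel 3 (CyclotomicField 3 ℚ))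
    (ι : PadicAlgCl 3 ≃+* ℂ) (e : K →+* ℂ) (S₀ : Finset (HeightOneSpectrum (𝓞 K)))
    (ρC : FramedGaloisRep K (PadicAlgCl 3) 3),
    Generic f → PicardInput f ι e S₀ ρC → ¬ Scope f ρC → ResidualHyp f hcpt → LimitConcl f hcpt

/-! ## 4. Kernel-checked glue of the skeleton: enough Lie places (used by the composition `MuOrdinaryFamilyRT_of`) -/

/-- A Lie-killing place modulo `3^N` is one modulo `3^M` for `M ≤ N`. -/
theorem LiePlaceAt.mono {f : ℤ[X]} {ρ : FramedGaloisRep K (PadicAlgCl 3) 3} {M N : ℕ}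
    {v : HeightOneSpectrum (𝓞 K)} (hMN : M ≤ N) (h : LiePlaceAt f ρ N v) : LiePlaceAt f ρ M v := by
  obtain ⟨h3, h9, hroots, hunr, a, ha, hSt⟩ := h
  refine ⟨h3, h9, hroots, hunr, a, ha, fun 𝔓 h𝔓 τ hτ i => (hSt 𝔓 h𝔓 τ hτ i).trans ?_⟩
  exact pow_le_pow_of_le_one (by positivity) (by norm_num) hMN

/-- From `HasLiePlaces`: for every `N`, `r` and `S₀` there is a set of at least `r` Lie-killing places mod `3^N` disjoint
from `S₀` (induction on `r`, avoiding `S₀ ∪ Y`). -/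
theorem exists_finset_liePlaces : ∀ {f : ℤ[X]} {ρ : FramedGaloisRep K (PadicAlgCl 3) 3}, HasLiePlaces f ρ →
    ∀ (N r : ℕ) (S₀ : Finset (HeightOneSpectrum (𝓞 K))),
    ∃ Y : Finset (HeightOneSpectrum (𝓞 K)), r ≤ Y.card ∧ Disjoint Y S₀ ∧ ∀ v ∈ Y, LiePlaceAt f ρ N v := by
  intro f ρ h N r S₀
  induction r with
  | zero => exact ⟨∅, le_rfl, Finset.disjoint_empty_left _, fun v hv => absurd hv (Finset.notMem_empty v)⟩
  | succ r ih =>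
    obtain ⟨Y, hcard, hdisj, hlie⟩ := ih
    obtain ⟨v, hv, hvlie⟩ := h N (S₀ ∪ Y)
    have hvS₀ : v ∉ S₀ := fun h' => hv (Finset.mem_union_left _ h')
    have hvY : v ∉ Y := fun h' => hv (Finset.mem_union_right _ h')
    refine ⟨insert v Y, ?_, ?_, ?_⟩
    · rw [Finset.card_insert_of_notMem hvY]; omega
    · rw [Finset.disjoint_insert_left]; exact ⟨hvS₀, hdisj⟩
    · intro w hw
      rcases Finset.mem_insert.mp hw with rfl | hw
      · exact hvlie
      · exact hlie w hw

end

end Summit.Langlands.Langlands.Cruxes.MuOrdinaryFamilyRT.Mod3nSuccessiveApproximation
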